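import Summits.NavierStokesRegularity.NavierStokesRegularity.Theorems.AxisymmetricExtremalityAxisymmetricKatoGlobalStubSeregin2020TypeIILemma22ExcisionBallCutoffCosts
import HarnessLib

/-!
# Seregin 2020, Lemma 2.2: the space–time error terms of the cut energy inequality — L22-B, piece F3b.4 (weighted forms)

Seat ns-es-p1 g3 (INPUTS A1 / L22-B; cut owner ns-inputs-plan g5; kit `A1-L22B-F3.md`; consumer: the F3c seat ns-in-ser-b).  On a step
`[a, b]` of the excision schedule the energy inequality (N–U 2012 (3.9)) is applied to `Θ · P`, `P = ∏_{i∈A}(1 - ψᵢ)` the product cut-off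
of the active balls; expanding `∇(ΘP)`, `∇((ΘP)²)` produces three error integrals over `[a,b] × ℝ³` with a bounded weight
`W(t,y)` (`= η(t) H(Φ̃(t,y)) Θ(y)²` or similar, `|W| ≤ C_W`):

* `integral_weight_mul_comp_snd_le` — the template: `g ≥ 0` integrable on `ℝ³`, `|W| ≤ C_W` measurable ⇒ `W·(g∘snd)` is integrable on
  `[a,b] × ℝ³` and `∬ |W| g ≤ C_W (b-a) ∫ g`;
* `excisionError_gradSq` (e1) — `∬_{[a,b]×ℝ³} |W| ‖DP‖² ≤ C_W (b-a) · 64|B₁| C₀² ∑ᵢ∑ⱼ min(rᵢ,rⱼ)³/(rᵢrⱼ)`;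
* `excisionError_axis` (e3) — `∬ |W| ‖DP‖/ϱ ≤ C_W (b-a) · 16 C_ax C₀ ∑ᵢ rᵢ`;
* `excisionError_drift` (e2) — `∬ |W| ‖U‖ ‖DP‖ ≤ C_W (∬_{[a,b]×O} ‖U‖³)^{1/3} (b-a)^{2/3} (64|B₁|)^{2/3} C₀ ∑ᵢ rᵢ` when `W = 0` off `O`.

WHAT THIS IS NOT: nothing about Navier–Stokes; no summit statement is proved here. [NazarovUraltseva2012 §3 (3.9); Seregin2020 §3]
-/

-- the problem directory repeats the summit name (D-0017); core's `dupNamespace` linter fires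
set_option linter.dupNamespace false

noncomputable section

open MeasureTheory Set Function Filter Topology TopologicalSpace Metric
open scoped NNReal ENNReal

namespace Summit.NavierStokesRegularity.NavierStokesRegularity.Theorems.AxisymmetricKatoGlobal.EulerScaling

open Literature.Analysis.FluidPDE

/-- `vol|_{[a,b] × ℝ³} = vol|_{[a,b]} ⊗ vol`. [folklore] -/
theorem restrict_Icc_prod_univ (a b : ℝ) :
    (volume : Measure (ℝ × EuclideanSpace ℝ (Fin 3))).restrict (Icc a b ×ˢ (univ : Set (EuclideanSpace ℝ (Fin 3)))) =
      (volume.restrict (Icc a b)).prod (volume : Measure (EuclideanSpace ℝ (Fin 3))) := by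
  rw [Measure.volume_eq_prod, ← Measure.restrict_univ (μ := (volume : Measure (EuclideanSpace ℝ (Fin 3)))),
    Measure.prod_restrict, Measure.restrict_univ]

/-- **Template.** For `g ≥ 0` integrable on `ℝ³` and a measurable weight `|W| ≤ C_W` on `[a,b] × ℝ³`: `W · (g ∘ snd)` is integrable
on `[a,b] × ℝ³` and `∬ |W| g ≤ C_W (b - a) ∫ g`. [folklore] -/
theorem integral_weight_mul_comp_snd_le {a b : ℝ} (hab : a ≤ b) {g : EuclideanSpace ℝ (Fin 3) → ℝ} (hg : Integrable g)
    (hg0 : ∀ y, 0 ≤ g y) {W : ℝ × EuclideanSpace ℝ (Fin 3) → ℝ} {CW : ℝ}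
    (hWm : AEStronglyMeasurable W (volume.restrict (Icc a b ×ˢ (univ : Set (EuclideanSpace ℝ (Fin 3))))))
    (hWb : ∀ z, |W z| ≤ CW) :
    Integrable (fun z : ℝ × EuclideanSpace ℝ (Fin 3) => W z * g z.2)
      (volume.restrict (Icc a b ×ˢ (univ : Set (EuclideanSpace ℝ (Fin 3))))) ∧
    ∫ z in Icc a b ×ˢ (univ : Set (EuclideanSpace ℝ (Fin 3))), |W z| * g z.2 ≤ CW * (b - a) * ∫ y, g y := by
  have hCW : 0 ≤ CW := (abs_nonneg _).trans (hWb (a, 0))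
  rw [restrict_Icc_prod_univ] at hWm ⊢
  set μ := ((volume : Measure ℝ).restrict (Icc a b)).prod (volume : Measure (EuclideanSpace ℝ (Fin 3))) with hμ
  haveI : IsFiniteMeasure ((volume : Measure ℝ).restrict (Icc a b)) := by
    refine ⟨?_⟩; rw [Measure.restrict_apply_univ, Real.volume_Icc]; exact ENNReal.ofReal_lt_top
  have hG : Integrable (fun z : ℝ × EuclideanSpace ℝ (Fin 3) => g z.2) μ := by
    have := (integrable_const (1 : ℝ) (μ := (volume : Measure ℝ).restrict (Icc a b))).mul_prod hg
    simpa only [one_mul] using this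
  have hWb' : ∀ᵐ z ∂μ, ‖W z‖ ≤ CW := Eventually.of_forall fun z => by rw [Real.norm_eq_abs]; exact hWb z
  have hI : Integrable (fun z : ℝ × EuclideanSpace ℝ (Fin 3) => W z * g z.2) μ := hG.bdd_mul hWm hWb'
  refine ⟨hI, ?_⟩
  have hIabs : Integrable (fun z : ℝ × EuclideanSpace ℝ (Fin 3) => |W z| * g z.2) μ :=
    hG.bdd_mul hWm.norm (Eventually.of_forall fun z => by rw [norm_norm, Real.norm_eq_abs]; exact hWb z) |>.congr
      (Eventually.of_forall fun z => by simp only [Real.norm_eq_abs])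
  calc ∫ z, |W z| * g z.2 ∂μ ≤ ∫ z, CW * g z.2 ∂μ :=
        integral_mono hIabs (hG.const_mul CW) fun z => mul_le_mul_of_nonneg_right (hWb z) (hg0 z.2)
    _ = CW * ((b - a) * ∫ y, g y) := by
        rw [MeasureTheory.integral_const_mul]
        congr 1
        have := integral_prod_mul (μ := (volume : Measure ℝ).restrict (Icc a b))
          (ν := (volume : Measure (EuclideanSpace ℝ (Fin 3)))) (fun _ : ℝ => (1 : ℝ)) g
        simp only [one_mul] at this
        rw [this, integral_const, smul_eq_mul, Measure.real, Measure.restrict_apply_univ, Real.volume_Icc,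
          ENNReal.toReal_ofReal (sub_nonneg.2 hab), mul_one]
    _ = CW * (b - a) * ∫ y, g y := by ring

/-- **(e1) the `|∇Θ_A|²` error:** `∬_{[a,b]×ℝ³} |W| ‖DP‖² ≤ C_W (b-a) · 64|B₁| C₀² ∑_{i,j∈A} min(rᵢ,rⱼ)³/(rᵢrⱼ)`, with the
integrability of `W · ‖DP∘snd‖²`. [cite: NazarovUraltseva2012, §3 (3.9)] -/
theorem excisionError_gradSq {A : Finset ℕ} {ψ : ℕ → EuclideanSpace ℝ (Fin 3) → ℝ}
    {x : ℕ → EuclideanSpace ℝ (Fin 3)} {r : ℕ → ℝ} {C₀ : ℝ} (hr : ∀ i ∈ A, 0 < r i) (hC₀ : 0 ≤ C₀)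
    (hψ : ∀ i ∈ A, ContDiff ℝ 1 (ψ i)) (h0 : ∀ i ∈ A, ∀ y, 0 ≤ ψ i y) (h1 : ∀ i ∈ A, ∀ y, ψ i y ≤ 1)
    (hgrad : ∀ i ∈ A, ∀ y, ‖fderiv ℝ (ψ i) y‖ ≤ C₀ / r i)
    (hgrad0 : ∀ i ∈ A, ∀ y, y ∉ ball (x i) (4 * r i) → fderiv ℝ (ψ i) y = 0)
    {a b : ℝ} (hab : a ≤ b) {W : ℝ × EuclideanSpace ℝ (Fin 3) → ℝ} {CW : ℝ}
    (hWm : AEStronglyMeasurable W (volume.restrict (Icc a b ×ˢ (univ : Set (EuclideanSpace ℝ (Fin 3))))))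
    (hWb : ∀ z, |W z| ≤ CW) :
    Integrable (fun z : ℝ × EuclideanSpace ℝ (Fin 3) => W z * ‖fderiv ℝ (fun y => ∏ i ∈ A, (1 - ψ i y)) z.2‖ ^ 2)
      (volume.restrict (Icc a b ×ˢ (univ : Set (EuclideanSpace ℝ (Fin 3))))) ∧
    ∫ z in Icc a b ×ˢ (univ : Set (EuclideanSpace ℝ (Fin 3))), |W z| * ‖fderiv ℝ (fun y => ∏ i ∈ A, (1 - ψ i y)) z.2‖ ^ 2 ≤
      CW * (b - a) * (64 * (Real.pi * 4 / 3) * C₀ ^ 2 * ∑ i ∈ A, ∑ j ∈ A, min (r i) (r j) ^ 3 / (r i * r j)) := by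
  obtain ⟨hInt, hle⟩ := integral_norm_fderiv_prodCut_sq_le hr hC₀ hψ h0 h1 hgrad hgrad0
  obtain ⟨hI, hb⟩ := integral_weight_mul_comp_snd_le hab hInt (fun y => sq_nonneg _) hWm hWb
  have hCW : 0 ≤ CW := (abs_nonneg _).trans (hWb (a, 0))
  exact ⟨hI, hb.trans (mul_le_mul_of_nonneg_left hle (mul_nonneg hCW (sub_nonneg.2 hab)))⟩

/-- **(e3) the axis-drift error:** with `∫_{B(x₀,ρ)} ϱ⁻¹ ≤ C_ax ρ²` (`lintegral_inv_cylRadius_rpow_ball_le 1`):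
`∬_{[a,b]×ℝ³} |W| ‖DP‖/ϱ ≤ C_W (b-a) · 16 C_ax C₀ ∑_{i∈A} rᵢ`, with the integrability of `W · (‖DP‖/ϱ)∘snd`.
[cite: NazarovUraltseva2012, §3 (3.9)] -/
theorem excisionError_axis {Cax : ℝ≥0}
    (hCax : ∀ (x₀ : EuclideanSpace ℝ (Fin 3)) (ρ : ℝ), 0 < ρ →
      ∫⁻ y in ball x₀ ρ, ENNReal.ofReal ((cylRadius y)⁻¹) ≤ (Cax : ℝ≥0∞) * ENNReal.ofReal (ρ ^ 2))
    {A : Finset ℕ} {ψ : ℕ → EuclideanSpace ℝ (Fin 3) → ℝ}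
    {x : ℕ → EuclideanSpace ℝ (Fin 3)} {r : ℕ → ℝ} {C₀ : ℝ} (hr : ∀ i ∈ A, 0 < r i) (hC₀ : 0 ≤ C₀)
    (hψ : ∀ i ∈ A, ContDiff ℝ 1 (ψ i)) (h0 : ∀ i ∈ A, ∀ y, 0 ≤ ψ i y) (h1 : ∀ i ∈ A, ∀ y, ψ i y ≤ 1)
    (hgrad : ∀ i ∈ A, ∀ y, ‖fderiv ℝ (ψ i) y‖ ≤ C₀ / r i)
    (hgrad0 : ∀ i ∈ A, ∀ y, y ∉ ball (x i) (4 * r i) → fderiv ℝ (ψ i) y = 0)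
    {a b : ℝ} (hab : a ≤ b) {W : ℝ × EuclideanSpace ℝ (Fin 3) → ℝ} {CW : ℝ}
    (hWm : AEStronglyMeasurable W (volume.restrict (Icc a b ×ˢ (univ : Set (EuclideanSpace ℝ (Fin 3))))))
    (hWb : ∀ z, |W z| ≤ CW) :
    Integrable (fun z : ℝ × EuclideanSpace ℝ (Fin 3) =>
        W z * (‖fderiv ℝ (fun y => ∏ i ∈ A, (1 - ψ i y)) z.2‖ / cylRadius z.2))
      (volume.restrict (Icc a b ×ˢ (univ : Set (EuclideanSpace ℝ (Fin 3))))) ∧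
    ∫ z in Icc a b ×ˢ (univ : Set (EuclideanSpace ℝ (Fin 3))),
        |W z| * (‖fderiv ℝ (fun y => ∏ i ∈ A, (1 - ψ i y)) z.2‖ / cylRadius z.2) ≤
      CW * (b - a) * ((Cax : ℝ) * (16 * C₀ * ∑ i ∈ A, r i)) := by
  set g : EuclideanSpace ℝ (Fin 3) → ℝ := fun y => ‖fderiv ℝ (fun y => ∏ i ∈ A, (1 - ψ i y)) y‖ / cylRadius y with hg
  have hg0 : ∀ y, 0 ≤ g y := fun y => div_nonneg (norm_nonneg _) (cylRadius_nonneg _)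
  have hgm : AEStronglyMeasurable g volume :=
    ((continuous_fderiv_prodCut hψ).norm.measurable.div continuous_cylRadius.measurable).aestronglyMeasurable
  have hlin := lintegral_norm_fderiv_prodCut_div_cylRadius_le (Cax := (Cax : ℝ≥0∞)) hCax hr hC₀ hψ h0 h1 hgrad hgrad0
  have hfin : ∫⁻ y, ENNReal.ofReal (g y) < ⊤ :=
    hlin.trans_lt (ENNReal.mul_lt_top ENNReal.coe_lt_top ENNReal.ofReal_lt_top)
  have hInt : Integrable g := by
    refine ⟨hgm, ?_⟩
    rw [HasFiniteIntegral]
    calc ∫⁻ y, ‖g y‖ₑ = ∫⁻ y, ENNReal.ofReal (g y) := lintegral_congr fun y => Real.enorm_eq_ofReal (hg0 y)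
      _ < ⊤ := hfin
  have hval : ∫ y, g y ≤ (Cax : ℝ) * (16 * C₀ * ∑ i ∈ A, r i) := by
    have hnn : 0 ≤ 16 * C₀ * ∑ i ∈ A, r i := by
      have := Finset.sum_nonneg fun i hi => (hr i hi).le; positivity
    rw [integral_eq_lintegral_of_nonneg_ae (Eventually.of_forall hg0) hgm]
    have := ENNReal.toReal_mono (ENNReal.mul_ne_top ENNReal.coe_ne_top ENNReal.ofReal_ne_top) hlin
    rwa [ENNReal.toReal_mul, ENNReal.coe_toReal, ENNReal.toReal_ofReal hnn] at this
  obtain ⟨hI, hb⟩ := integral_weight_mul_comp_snd_le hab hInt hg0 hWm hWb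
  have hCW : 0 ≤ CW := (abs_nonneg _).trans (hWb (a, 0))
  exact ⟨hI, hb.trans (mul_le_mul_of_nonneg_left hval (mul_nonneg hCW (sub_nonneg.2 hab)))⟩

/-- `∬_{[a,b]×ℝ³} ‖DP(z.2)‖^{3/2} = (b-a) ∫ ‖DP‖^{3/2} ≤ (b-a) ((64|B₁|)^{2/3} C₀ ∑ rᵢ)^{3/2}` (lintegral form). [folklore] -/
theorem lintegral_Icc_prod_enorm_fderiv_prodCut_rpow_le {A : Finset ℕ} {ψ : ℕ → EuclideanSpace ℝ (Fin 3) → ℝ}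
    {x : ℕ → EuclideanSpace ℝ (Fin 3)} {r : ℕ → ℝ} {C₀ : ℝ} (hr : ∀ i ∈ A, 0 < r i) (hC₀ : 0 ≤ C₀)
    (hψ : ∀ i ∈ A, ContDiff ℝ 1 (ψ i)) (h0 : ∀ i ∈ A, ∀ y, 0 ≤ ψ i y) (h1 : ∀ i ∈ A, ∀ y, ψ i y ≤ 1)
    (hgrad : ∀ i ∈ A, ∀ y, ‖fderiv ℝ (ψ i) y‖ ≤ C₀ / r i)
    (hgrad0 : ∀ i ∈ A, ∀ y, y ∉ ball (x i) (4 * r i) → fderiv ℝ (ψ i) y = 0) (a b : ℝ) :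
    ∫⁻ z in Icc a b ×ˢ (univ : Set (EuclideanSpace ℝ (Fin 3))),
        ‖fderiv ℝ (fun y => ∏ i ∈ A, (1 - ψ i y)) z.2‖ₑ ^ (3 / 2 : ℝ) ≤
      ENNReal.ofReal (b - a) * ENNReal.ofReal ((64 * (Real.pi * 4 / 3)) ^ (2 / 3 : ℝ) * C₀ * ∑ i ∈ A, r i) ^ (3 / 2 : ℝ) := by
  set P : EuclideanSpace ℝ (Fin 3) → ℝ := fun y => ∏ i ∈ A, (1 - ψ i y) with hP
  have hp0 : ENNReal.ofReal (3 / 2) ≠ 0 := (ENNReal.ofReal_pos.2 (by norm_num)).ne'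
  have hgm : AEMeasurable (fun y => ‖fderiv ℝ P y‖ₑ ^ (3 / 2 : ℝ)) volume :=
    ((continuous_fderiv_prodCut hψ).measurable.enorm.pow_const _).aemeasurable
  rw [restrict_Icc_prod_univ]
  have e := lintegral_prod_mul (μ := (volume : Measure ℝ).restrict (Icc a b))
    (ν := (volume : Measure (EuclideanSpace ℝ (Fin 3)))) (f := fun _ => (1 : ℝ≥0∞))
    (g := fun y => ‖fderiv ℝ P y‖ₑ ^ (3 / 2 : ℝ)) aemeasurable_const hgm
  simp only [one_mul, lintegral_const, Measure.restrict_apply_univ, Real.volume_Icc] at e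
  rw [e]
  gcongr
  -- `∫ ‖DP‖^{3/2} = ‖DP‖_{3/2}^{3/2}`
  have hS := eLpNorm_fderiv_prodCut_le hr hC₀ hψ h0 h1 hgrad hgrad0
  rw [eLpNorm_eq_lintegral_rpow_enorm_toReal hp0 ENNReal.ofReal_ne_top, ENNReal.toReal_ofReal (by norm_num)] at hS
  have := ENNReal.rpow_le_rpow hS (by norm_num : (0 : ℝ) ≤ 3 / 2)
  rwa [← ENNReal.rpow_mul, show (1 / (3 / 2 : ℝ)) * (3 / 2) = 1 by norm_num, ENNReal.rpow_one] at this

/-- **(e2) the drift error (Hölder `3`–`3/2`):** for a measurable weight `|W| ≤ C_W` on `[a,b] × ℝ³` vanishing when `z.2 ∉ O`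
(any `O`, e.g. `B(0, 2R) ⊇ tsupport Θ`) and a drift `U` with `‖U‖³` of finite integral on `[a,b] × O`:
`W · ‖U‖ · ‖DP∘snd‖` is integrable on `[a,b] × ℝ³` and
`∬ |W| ‖U‖ ‖DP‖ ≤ C_W (∬_{[a,b]×O} ‖U‖³)^{1/3} (b-a)^{2/3} (64|B₁|)^{2/3} C₀ ∑_{i∈A} rᵢ`. [cite: NazarovUraltseva2012, §3 (3.9)] -/
theorem excisionError_drift {A : Finset ℕ} {ψ : ℕ → EuclideanSpace ℝ (Fin 3) → ℝ}
    {x : ℕ → EuclideanSpace ℝ (Fin 3)} {r : ℕ → ℝ} {C₀ : ℝ} (hr : ∀ i ∈ A, 0 < r i) (hC₀ : 0 ≤ C₀)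
    (hψ : ∀ i ∈ A, ContDiff ℝ 1 (ψ i)) (h0 : ∀ i ∈ A, ∀ y, 0 ≤ ψ i y) (h1 : ∀ i ∈ A, ∀ y, ψ i y ≤ 1)
    (hgrad : ∀ i ∈ A, ∀ y, ‖fderiv ℝ (ψ i) y‖ ≤ C₀ / r i)
    (hgrad0 : ∀ i ∈ A, ∀ y, y ∉ ball (x i) (4 * r i) → fderiv ℝ (ψ i) y = 0)
    {a b : ℝ} (hab : a ≤ b) {O : Set (EuclideanSpace ℝ (Fin 3))}
    {U : ℝ → EuclideanSpace ℝ (Fin 3) → EuclideanSpace ℝ (Fin 3)}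
    (hUm : AEStronglyMeasurable (uncurry U) (volume.restrict (Icc a b ×ˢ O)))
    (hU3 : (∫⁻ z in Icc a b ×ˢ O, ‖U z.1 z.2‖ₑ ^ (3 : ℕ)) ≠ ⊤)
    {W : ℝ × EuclideanSpace ℝ (Fin 3) → ℝ} {CW : ℝ}
    (hWm : AEStronglyMeasurable W (volume.restrict (Icc a b ×ˢ (univ : Set (EuclideanSpace ℝ (Fin 3))))))
    (hWb : ∀ z, |W z| ≤ CW) (hWO : ∀ z : ℝ × EuclideanSpace ℝ (Fin 3), z.2 ∉ O → W z = 0) :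
    Integrable (fun z : ℝ × EuclideanSpace ℝ (Fin 3) =>
        W z * (‖U z.1 z.2‖ * ‖fderiv ℝ (fun y => ∏ i ∈ A, (1 - ψ i y)) z.2‖))
      (volume.restrict (Icc a b ×ˢ (univ : Set (EuclideanSpace ℝ (Fin 3))))) ∧
    ∫ z in Icc a b ×ˢ (univ : Set (EuclideanSpace ℝ (Fin 3))),
        |W z| * (‖U z.1 z.2‖ * ‖fderiv ℝ (fun y => ∏ i ∈ A, (1 - ψ i y)) z.2‖) ≤
      CW * ((∫⁻ z in Icc a b ×ˢ O, ‖U z.1 z.2‖ₑ ^ (3 : ℕ)).toReal ^ (1 / 3 : ℝ) *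
        ((b - a) ^ (2 / 3 : ℝ) * ((64 * (Real.pi * 4 / 3)) ^ (2 / 3 : ℝ) * C₀ * ∑ i ∈ A, r i))) := by
  set P : EuclideanSpace ℝ (Fin 3) → ℝ := fun y => ∏ i ∈ A, (1 - ψ i y) with hP
  set μO := (volume : Measure (ℝ × EuclideanSpace ℝ (Fin 3))).restrict (Icc a b ×ˢ O) with hμO
  set K : ℝ := (64 * (Real.pi * 4 / 3)) ^ (2 / 3 : ℝ) * C₀ * ∑ i ∈ A, r i with hK
  have hK0 : 0 ≤ K := by
    have := Finset.sum_nonneg fun i hi => (hr i hi).le; rw [hK]; positivity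
  have hCW : 0 ≤ CW := (abs_nonneg _).trans (hWb (a, 0))
  have hsub : Icc a b ×ˢ O ⊆ Icc a b ×ˢ (univ : Set (EuclideanSpace ℝ (Fin 3))) := prod_mono le_rfl (subset_univ _)
  have hPc : Continuous fun y => fderiv ℝ P y := continuous_fderiv_prodCut hψ
  -- ### Hölder in `ℝ≥0∞`
  set NU : ℝ≥0∞ := (∫⁻ z in Icc a b ×ˢ O, ‖U z.1 z.2‖ₑ ^ (3 : ℕ)) ^ (1 / 3 : ℝ) with hNU
  have hNUfin : NU ≠ ⊤ := by rw [hNU]; exact ENNReal.rpow_ne_top_of_nonneg (by norm_num) hU3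
  have hfm : AEMeasurable (fun z : ℝ × EuclideanSpace ℝ (Fin 3) => ‖U z.1 z.2‖ₑ) μO := hUm.enorm
  have hgm : AEMeasurable (fun z : ℝ × EuclideanSpace ℝ (Fin 3) => ‖fderiv ℝ P z.2‖ₑ) μO :=
    (hPc.measurable.comp measurable_snd).enorm.aemeasurable
  have hpq : (3 : ℝ).HolderConjugate (3 / 2) := Real.holderConjugate_iff.2 ⟨by norm_num, by norm_num⟩
  have hHolder := ENNReal.lintegral_mul_le_Lp_mul_Lq μO hpq hfm hgm
  have hL1 : ∫⁻ z, ‖U z.1 z.2‖ₑ * ‖fderiv ℝ P z.2‖ₑ ∂μO ≤ NU * (ENNReal.ofReal (b - a) ^ (2 / 3 : ℝ) * ENNReal.ofReal K) := by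
    refine hHolder.trans ?_
    have e3 : (fun z : ℝ × EuclideanSpace ℝ (Fin 3) => ‖U z.1 z.2‖ₑ ^ (3 : ℝ)) = fun z => ‖U z.1 z.2‖ₑ ^ (3 : ℕ) := by
      funext z; exact_mod_cast ENNReal.rpow_natCast _ 3
    rw [e3]
    -- the `3/2`-factor
    have hmono : ∫⁻ z, ‖fderiv ℝ P z.2‖ₑ ^ (3 / 2 : ℝ) ∂μO ≤
        ∫⁻ z in Icc a b ×ˢ (univ : Set (EuclideanSpace ℝ (Fin 3))), ‖fderiv ℝ P z.2‖ₑ ^ (3 / 2 : ℝ) :=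
      lintegral_mono_set hsub
    have hb := lintegral_Icc_prod_enorm_fderiv_prodCut_rpow_le hr hC₀ hψ h0 h1 hgrad hgrad0 a b
    have h32 : (∫⁻ z, ‖fderiv ℝ P z.2‖ₑ ^ (3 / 2 : ℝ) ∂μO) ^ (1 / (3 / 2) : ℝ) ≤
        ENNReal.ofReal (b - a) ^ (2 / 3 : ℝ) * ENNReal.ofReal K := by
      calc (∫⁻ z, ‖fderiv ℝ P z.2‖ₑ ^ (3 / 2 : ℝ) ∂μO) ^ (1 / (3 / 2) : ℝ)
          ≤ (ENNReal.ofReal (b - a) * ENNReal.ofReal K ^ (3 / 2 : ℝ)) ^ (1 / (3 / 2) : ℝ) :=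
            ENNReal.rpow_le_rpow (hmono.trans hb) (by norm_num)
        _ = ENNReal.ofReal (b - a) ^ (2 / 3 : ℝ) * ENNReal.ofReal K := by
            rw [ENNReal.mul_rpow_of_nonneg _ _ (by norm_num), ← ENNReal.rpow_mul,
              show (3 / 2 : ℝ) * (1 / (3 / 2)) = 1 by norm_num, ENNReal.rpow_one, show (1 / (3 / 2) : ℝ) = 2 / 3 by norm_num]
    exact mul_le_mul' le_rfl h32
  have hRfin : NU * (ENNReal.ofReal (b - a) ^ (2 / 3 : ℝ) * ENNReal.ofReal K) ≠ ⊤ :=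
    ENNReal.mul_ne_top hNUfin (ENNReal.mul_ne_top (ENNReal.rpow_ne_top_of_nonneg (by norm_num) ENNReal.ofReal_ne_top)
      ENNReal.ofReal_ne_top)
  -- ### the real integrand on `[a,b] × O`
  set f : ℝ × EuclideanSpace ℝ (Fin 3) → ℝ := fun z => ‖U z.1 z.2‖ * ‖fderiv ℝ P z.2‖ with hf
  have hf0 : ∀ z, 0 ≤ f z := fun z => mul_nonneg (norm_nonneg _) (norm_nonneg _)
  have hfmeas : AEStronglyMeasurable f μO := hUm.norm.mul (hPc.comp continuous_snd).norm.aestronglyMeasurable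
  have hfe : ∀ z, ‖f z‖ₑ = ‖U z.1 z.2‖ₑ * ‖fderiv ℝ P z.2‖ₑ := fun z => by
    rw [hf]; simp only; rw [enorm_mul, enorm_norm, enorm_norm]
  have hfI : Integrable f μO := by
    refine ⟨hfmeas, ?_⟩
    rw [HasFiniteIntegral]
    calc ∫⁻ z, ‖f z‖ₑ ∂μO = ∫⁻ z, ‖U z.1 z.2‖ₑ * ‖fderiv ℝ P z.2‖ₑ ∂μO := lintegral_congr fun z => hfe z
      _ < ⊤ := hL1.trans_lt (lt_top_iff_ne_top.2 hRfin)
  have hfint : ∫ z, f z ∂μO ≤ NU.toReal * ((b - a) ^ (2 / 3 : ℝ) * K) := by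
    rw [integral_eq_lintegral_of_nonneg_ae (Eventually.of_forall hf0) hfmeas]
    have e1 : ∫⁻ z, ENNReal.ofReal (f z) ∂μO = ∫⁻ z, ‖U z.1 z.2‖ₑ * ‖fderiv ℝ P z.2‖ₑ ∂μO :=
      lintegral_congr fun z => by rw [← hfe z, Real.enorm_eq_ofReal (hf0 z)]
    rw [e1]
    have e2 : (ENNReal.ofReal (b - a) ^ (2 / 3 : ℝ) * ENNReal.ofReal K).toReal = (b - a) ^ (2 / 3 : ℝ) * K := by
      rw [ENNReal.toReal_mul, ← ENNReal.toReal_rpow, ENNReal.toReal_ofReal (sub_nonneg.2 hab), ENNReal.toReal_ofReal hK0]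
    have := ENNReal.toReal_mono hRfin hL1
    rwa [ENNReal.toReal_mul, e2] at this
  -- ### the weighted integrand: integrable on `[a,b] × O`, zero on `[a,b] × Oᶜ`
  have hWmO : AEStronglyMeasurable W μO := hWm.mono_measure (Measure.restrict_mono hsub le_rfl)
  have hIO : Integrable (fun z => W z * f z) μO :=
    hfI.bdd_mul hWmO (Eventually.of_forall fun z => by rw [Real.norm_eq_abs]; exact hWb z)
  have hzero : ∀ z ∈ Icc a b ×ˢ (univ : Set (EuclideanSpace ℝ (Fin 3))) \ Icc a b ×ˢ O, W z * f z = 0 := by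
    rintro z ⟨hz, hz'⟩
    have : z.2 ∉ O := fun h => hz' ⟨hz.1, h⟩
    rw [hWO z this, zero_mul]
  have hzero' : ∀ z ∈ Icc a b ×ˢ (univ : Set (EuclideanSpace ℝ (Fin 3))) \ Icc a b ×ˢ O, |W z| * f z = 0 := by
    intro z hz; have := hzero z hz; rw [mul_eq_zero] at this ⊢
    exact this.imp (fun h => by rw [h, abs_zero]) id
  have hI : IntegrableOn (fun z => W z * f z) (Icc a b ×ˢ (univ : Set (EuclideanSpace ℝ (Fin 3)))) volume :=
    IntegrableOn.of_forall_sdiff_eq_zero hIO (measurableSet_Icc.prod MeasurableSet.univ) hzero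
  refine ⟨hI, ?_⟩
  rw [setIntegral_eq_of_subset_of_forall_sdiff_eq_zero (measurableSet_Icc.prod MeasurableSet.univ) hsub hzero']
  have hIabs : Integrable (fun z => |W z| * f z) μO :=
    hfI.bdd_mul hWmO.norm (Eventually.of_forall fun z => by rw [norm_norm, Real.norm_eq_abs]; exact hWb z) |>.congr
      (Eventually.of_forall fun z => by simp only [Real.norm_eq_abs])
  calc ∫ z, |W z| * f z ∂μO ≤ ∫ z, CW * f z ∂μO :=
        integral_mono hIabs (hfI.const_mul CW) fun z => mul_le_mul_of_nonneg_right (hWb z) (hf0 z)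
    _ = CW * ∫ z, f z ∂μO := MeasureTheory.integral_const_mul _ _
    _ ≤ CW * (NU.toReal * ((b - a) ^ (2 / 3 : ℝ) * K)) := mul_le_mul_of_nonneg_left hfint hCW
    _ = _ := by rw [hNU, ← ENNReal.toReal_rpow]

end Summit.NavierStokesRegularity.NavierStokesRegularity.Theorems.AxisymmetricKatoGlobal.EulerScaling

end
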